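import Literature.Analysis.FluidPDE.FujitaKatoPicard
import Literature.Analysis.FluidPDE.MildSolutionProofs
import Literature.Analysis.UnboundedOperators.HeatSemigroupLpProofs
import Literature.Analysis.UnboundedOperators.HeatSemigroupStrongContinuityProofs
import Literature.Analysis.UnboundedOperators.HeatKernelFourier
import Mathlib.Analysis.Fourier.Convolution
import Mathlib.Analysis.Distribution.SchwartzSpace.Fourier
import HarnessLib

/-!
# Caloric test fields on the Fourier side

Support file of the discharge programme for `Literature.Analysis.FluidPDE.fujita_kato_local`
(dictionary step `FujitaKato.exists_mildSolution_of_isFourierNSSolution`, plan in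
`Literature/Analysis/FluidPDE/FujitaKatoLocal.lean`). The tree's duality-form mild solutions
(`IsMildNSSolutionOn`, Fabes–Jones–Rivière 1972, Thm. 2.1) are tested against the caloric fields
`heatTest ν φ σ = e^{νσΔ} φ` of smooth compactly supported divergence-free `φ`; the Fourier-side
Duhamel formula of Lemarié-Rieusset 2023, §8.7 (8.8) meets them through their Fourier
transforms. This file provides, for a real test field `φ : ℝ^ι → ℝ^ι` (`IsTestFunctionOn ⊤ φ`):

* `compSchwartz hφ l`: the complexified component `x ↦ (φ(x)_l : ℂ)` as a Schwartz function, and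
  `Φ_l = 𝓕 (compSchwartz hφ l)`;
* `caloricSchwartz hφ ν σ l = e^{νσΔ} (compSchwartz hφ l)`, an `abbrev` for the tree's heat
  semigroup on Schwartz space `SchwartzMap.heatSemigroup (ν σ)` (`HeatSemigroup.lean`: the
  Fourier multiplier `𝓕⁻¹ e^{-(2π)²νσ‖ξ‖²} 𝓕`) applied to the complexified component, and the key
  NEW identity `caloricSchwartz_apply`: its values are the complexified components of the tree's
  caloric test field, `SchwartzMap.heatSemigroup (ν σ) (compSchwartz hφ l) x = ((heatTest ν φ σ x)_l : ℂ)`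
  for `ν > 0`, `σ ≥ 0`, i.e. the bridge `heatSemigroup t f = heatExtension f t` between the
  multiplier semigroup on `𝓢` and the kernel semigroup `heatExtension`/`heatFlow`/`heatTest`
  (convolution theorem `𝓕(G_t ⋆ g) = 𝓕G_t · 𝓕g`, `𝓕 G_t = e^{-(2π)²t‖ξ‖²}`
  (`fourierIntegral_heatKernel_holds`), and Fourier inversion for the continuous integrable
  function `G_t ⋆ g`) — this bridge was not in the tree (`lean search heatSemigroup heatExtension`);
* derivatives: `∂_{e_j}` of the caloric Schwartz function is the complexified component of
  `D(heatTest ν φ σ)(x) e_j`, with Fourier transform `2πi ζ_j e^{-(2π)²νσ‖ζ‖²} Φ_l(ζ)`;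
* incompressibility on the Fourier side: `∑_l ζ_l Φ_l(ζ) = 0` when `div φ = 0`;
* the quadratic form `⟪w, D(heatTest ν φ σ)(x) w⟫ = ∑_{l,j} w_l w_j ∂_{e_j}(caloricSchwartz_l)(x)`
  entering the nonlinear duality term `∫ ⟪u, (u·∇) e^{νσΔ}φ⟫`;
* `heatSymbol (ν s) ζ = heat ((2π)²ν) ζ s`, matching the rate `c = (2π)²ν` of the Fourier side.

## Mathlib / tree search

Mathlib: `HasCompactSupport.toSchwartzMap`, `SchwartzMap.smulLeftCLM` (temperate multipliers),
`SchwartzMap.fourier_lineDerivOp_eq`, `SchwartzMap.lineDerivOp_apply_eq_fderiv`,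
`Real.fourier_smul_convolution_eq`, `Continuous.fourierInv_fourier_eq`,
`HasCompactSupport.continuous_convolution_right`, `Integrable.integrable_convolution`.
Tree (reused, not re-created): the heat semigroup on Schwartz space `SchwartzMap.heatSemigroup`
with `heatSemigroup_zero`, `heatSemigroup_add` (`HeatSemigroup.lean`),
`heatSemigroup_apply_eq_fourierInv_smulLeftCLM`, `smulLeftCLM_heatSymbol_apply`
(`HeatSemigroupStrongContinuityProofs.lean`); `heatTest`, `heatFlow` (`MildSolution.lean`),
`contDiff_heatFlow` (`MildSolutionProofs.lean`; cf. `contDiff_heatTest` in `LerayHopfMild.lean`),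
`heatExtension`, `heatKernel`, `heatSymbol` (`HeatKernel.lean`),
`convolution_ofReal_heatKernel_eq_heatExtension` (`HeatSemigroupLpProofs.lean`),
`fourierIntegral_heatKernel_holds`, `integrable_heatKernel_holds`,
`divergence_eq_sum_inner_fderiv` (`VectorCalculus.lean`), `FourierNS.heat`,
`IsWeaklyDivFree.sum_coord_mul_fourier_apply_eq_zero` (`FujitaKatoLocal.lean`, the a.e./`L²` twin
of `sum_coord_mul_fourier_compSchwartz`), `IsTestFunctionOn.memLp_volume` (`LerayHopfTimeSlice.lean`,
not needed here). New relative to these: the pointwise identification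
`heatSemigroup`/`heatTest` for test-field components, and the derivative / incompressibility /
quadratic-form lemmas below.

## References

* P. G. Lemarié-Rieusset, *The Navier–Stokes problem in the 21st century*, 2nd ed., CRC Press
  2023, §8.7 (8.8), PDF p. 198; Thm. 6.1, PDF p. 135. [Lemarierieusset2023]
* E. B. Fabes, B. F. Jones, N. M. Rivière, Arch. Rational Mech. Anal. 45 (1972), Thm. 2.1.
-/

noncomputable section

open MeasureTheory Set Function Filter Topology Real SchwartzMap FourierTransform
  TopologicalSpace
open scoped ENNReal NNReal ComplexConjugate InnerProductSpace LineDeriv Convolution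

namespace Literature.Analysis.FluidPDE.FujitaKato

open FourierNS UnboundedOperators

variable {ι : Type*} [Fintype ι]

/-! ### Components of a real test field as Schwartz functions -/

section Components

variable {φ : EuclideanSpace ℝ ι → EuclideanSpace ℝ ι}

/-- The complexification of a coordinate, as a real-linear map `ℝ^ι → ℂ`. [folklore] -/
def coordC (l : ι) : EuclideanSpace ℝ ι →L[ℝ] ℂ :=
  Complex.ofRealCLM.comp (EuclideanSpace.proj (𝕜 := ℝ) l)

omit [Fintype ι] in
/-- Unfolding `coordC`. [folklore] -/
@[simp]
theorem coordC_apply (l : ι) (v : EuclideanSpace ℝ ι) : coordC l v = ((v l : ℝ) : ℂ) := rfl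

/-- A complexified component of a test field has compact support. [folklore] -/
theorem hasCompactSupport_coordC_comp (hφ : FunctionSpaces.IsTestFunctionOn (⊤ : Opens (EuclideanSpace ℝ ι)) φ)
    (l : ι) : HasCompactSupport fun x => ((φ x l : ℝ) : ℂ) :=
  hφ.hasCompactSupport.comp_left (g := fun v : EuclideanSpace ℝ ι => ((v l : ℝ) : ℂ)) (by simp)

/-- A complexified component of a test field is smooth. [folklore] -/
theorem contDiff_coordC_comp (hφ : FunctionSpaces.IsTestFunctionOn (⊤ : Opens (EuclideanSpace ℝ ι)) φ)
    (l : ι) : ContDiff ℝ (⊤ : ℕ∞) fun x => ((φ x l : ℝ) : ℂ) :=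
  (coordC l).contDiff.comp hφ.contDiff

/-- **The complexified component `x ↦ (φ(x)_l : ℂ)` of a test field as a Schwartz function.** [folklore] -/
def compSchwartz (hφ : FunctionSpaces.IsTestFunctionOn (⊤ : Opens (EuclideanSpace ℝ ι)) φ) (l : ι) :
    𝓢(EuclideanSpace ℝ ι, ℂ) :=
  (hasCompactSupport_coordC_comp hφ l).toSchwartzMap (contDiff_coordC_comp hφ l)

/-- Values of `compSchwartz`. [folklore] -/
@[simp]
theorem compSchwartz_apply (hφ : FunctionSpaces.IsTestFunctionOn (⊤ : Opens (EuclideanSpace ℝ ι)) φ)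
    (l : ι) (x : EuclideanSpace ℝ ι) : compSchwartz hφ l x = ((φ x l : ℝ) : ℂ) := rfl

end Components

/-! ### The heat symbol and the Fourier-side heat factor -/

section HeatMul

/-- The heat symbol at time `ν s` is the Fourier-side heat factor of rate `c = (2π)²ν`:
`heatSymbol (ν s) ζ = heat ((2π)²ν) ζ s`. [folklore] -/
theorem heatSymbol_eq_heat (ν s : ℝ) (ζ : EuclideanSpace ℝ ι) :
    heatSymbol (ν * s) ζ = heat ((2 * π) ^ 2 * ν) ζ s := by
  simp only [heatSymbol, heat]
  congr 1
  ring

end HeatMul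

/-! ### Fourier transforms of coordinate derivatives -/

section LineDeriv

/-- Fourier transform of a coordinate derivative of a Schwartz function:
`𝓕(∂_{e_l} Ψ)(ζ) = 2πi ζ_l 𝓕Ψ(ζ)` (Mathlib's `SchwartzMap.fourier_lineDerivOp_eq` with
`⟪ζ, e_l⟫ = ζ_l`). [folklore] -/
theorem fourier_lineDerivOp_single_apply [DecidableEq ι] (Ψ : 𝓢(EuclideanSpace ℝ ι, ℂ)) (l : ι)
    (ζ : EuclideanSpace ℝ ι) :
    (𝓕 (∂_{EuclideanSpace.single l (1 : ℝ)} Ψ)) ζ = (2 * π * Complex.I) * ((ζ l : ℝ) : ℂ) * (𝓕 Ψ) ζ := by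
  have htemp : (fun ξ : EuclideanSpace ℝ ι => ⟪ξ, EuclideanSpace.single l (1 : ℝ)⟫_ℝ).HasTemperateGrowth := by
    fun_prop
  have hinner : ⟪ζ, EuclideanSpace.single l (1 : ℝ)⟫_ℝ = ζ l := by
    simp [EuclideanSpace.inner_single_right]
  rw [fourier_lineDerivOp_eq, smul_apply, smulLeftCLM_apply_apply htemp, hinner, Complex.real_smul,
    smul_eq_mul]
  ring

end LineDeriv

/-! ### The caloric Schwartz functions -/

section Caloric

variable {φ : EuclideanSpace ℝ ι → EuclideanSpace ℝ ι} {ν : ℝ}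

/-- **The caloric Schwartz function** `e^{νσΔ} φ_l^ℂ = 𝓕⁻¹ (e^{-(2π)²νσ‖ξ‖²} 𝓕 φ_l^ℂ)`: an
`abbrev` for the tree's heat semigroup on Schwartz space `SchwartzMap.heatSemigroup (ν * σ)`
(`HeatSemigroup.lean`, the Fourier multiplier with symbol `heatSymbol`) applied to the
complexified component `compSchwartz hφ l` (Lemarié-Rieusset 2023, §8.7: `W_{νt} ∗ u₀` has Fourier
transform `e^{-νt|ξ|²} U₀`). [cite: Lemarierieusset2023, §8.7 (8.8) (PDF p. 198)] -/
abbrev caloricSchwartz (hφ : FunctionSpaces.IsTestFunctionOn (⊤ : Opens (EuclideanSpace ℝ ι)) φ) (ν σ : ℝ)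
    (l : ι) : 𝓢(EuclideanSpace ℝ ι, ℂ) :=
  SchwartzMap.heatSemigroup (ν * σ) (compSchwartz hφ l)

/-- The Fourier transform of the caloric Schwartz function is the heat multiplier of `Φ_l`
(`heatSemigroup_apply_eq_fourierInv_smulLeftCLM` and `𝓕 𝓕⁻¹ = id` on `𝓢`). [folklore] -/
theorem fourier_caloricSchwartz (hφ : FunctionSpaces.IsTestFunctionOn (⊤ : Opens (EuclideanSpace ℝ ι)) φ)
    (ν σ : ℝ) (l : ι) :
    𝓕 (caloricSchwartz hφ ν σ l) =
      SchwartzMap.smulLeftCLM ℂ (fun ξ : EuclideanSpace ℝ ι => (heatSymbol (ν * σ) ξ : ℂ))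
        (𝓕 (compSchwartz hφ l)) := by
  rw [caloricSchwartz, SchwartzMap.heatSemigroup_apply_eq_fourierInv_smulLeftCLM, fourier_fourierInv_eq]

/-- The Fourier transform of the caloric Schwartz function, pointwise:
`e^{-(2π)²νσ‖ζ‖²} Φ_l(ζ)` (hypothesis `0 ≤ ν σ`: the multiplier depends on the product only,
`smulLeftCLM_heatSymbol_apply`). [folklore] -/
theorem fourier_caloricSchwartz_apply (hφ : FunctionSpaces.IsTestFunctionOn (⊤ : Opens (EuclideanSpace ℝ ι)) φ)
    {σ : ℝ} (hνσ : 0 ≤ ν * σ) (l : ι) (ζ : EuclideanSpace ℝ ι) :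
    𝓕 (caloricSchwartz hφ ν σ l : EuclideanSpace ℝ ι → ℂ) ζ =
      (heatSymbol (ν * σ) ζ : ℂ) * 𝓕 (compSchwartz hφ l : EuclideanSpace ℝ ι → ℂ) ζ := by
  rw [← SchwartzMap.fourier_coe, fourier_caloricSchwartz, SchwartzMap.smulLeftCLM_heatSymbol_apply hνσ,
    smul_eq_mul, SchwartzMap.fourier_coe]

/-- The complexified component commutes with the caloric extension: for `0 < s`,
`((e^{sΔ}φ)(x)_l : ℂ) = e^{sΔ}(φ_l^ℂ)(x)`. [folklore] -/
theorem coordC_heatExtension (hφ : FunctionSpaces.IsTestFunctionOn (⊤ : Opens (EuclideanSpace ℝ ι)) φ)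
    {s : ℝ} (hs : 0 < s) (l : ι) (x : EuclideanSpace ℝ ι) :
    (((heatExtension φ s x) l : ℝ) : ℂ) = heatExtension (fun y => ((φ y l : ℝ) : ℂ)) s x := by
  rw [heatExtension_apply, heatExtension_apply]
  have hint : Integrable (fun y : EuclideanSpace ℝ ι => heatKernel s y • φ (x - y)) := by
    have h := (integrable_heatKernel_holds (E := EuclideanSpace ℝ ι) hs)
    obtain ⟨C, hC⟩ := (hφ.contDiff.continuous.norm).bddAbove_range_of_hasCompactSupport
      hφ.hasCompactSupport.norm
    refine (h.norm.mul_const C).mono' ?_ (Eventually.of_forall fun y => ?_)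
    · exact h.aestronglyMeasurable.smul
        ((hφ.contDiff.continuous.comp (continuous_const.sub continuous_id)).aestronglyMeasurable)
    · rw [norm_smul]
      exact mul_le_mul_of_nonneg_left (hC ⟨x - y, rfl⟩) (norm_nonneg _)
  have h := (coordC (ι := ι) l).integral_comp_comm hint
  simp only [coordC_apply, map_smul] at h
  rw [← h]

/-- **The caloric Schwartz function is the complexified component of the caloric test field**:
`SchwartzMap.heatSemigroup (ν σ) φ_l^ℂ (x) = ((heatTest ν φ σ x)_l : ℂ)` for `ν > 0`, `σ ≥ 0` —
the bridge between the multiplier semigroup `SchwartzMap.heatSemigroup` on `𝓢` and the kernel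
semigroup `heatExtension` / `heatFlow` / `heatTest` of the tree, for test-field components (the
heat semigroup as the Fourier multiplier `e^{-(2π)²t‖ξ‖²}`: `𝓕(G_t ⋆ g) = e^{-(2π)²t‖ξ‖²} 𝓕g`
and Fourier inversion; Lemarié-Rieusset 2023, §8.7; Stein–Weiss 1971, Ch. I, Thm. 1.13). The
hypotheses are needed in this shape: for `ν < 0 < σ` the left side is junk (`smulLeftCLM` of a
non-temperate symbol) while the right side is `e^{νσΔ}`-free. [cite: Lemarierieusset2023, §8.7 (8.8) (PDF p. 198)] -/
theorem caloricSchwartz_apply (hφ : FunctionSpaces.IsTestFunctionOn (⊤ : Opens (EuclideanSpace ℝ ι)) φ)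
    (hν : 0 < ν) {σ : ℝ} (hσ : 0 ≤ σ) (l : ι) (x : EuclideanSpace ℝ ι) :
    caloricSchwartz hφ ν σ l x = (((heatTest ν φ σ x) l : ℝ) : ℂ) := by
  rcases hσ.eq_or_lt with rfl | hσ0
  · -- `σ = 0`: `e^{0Δ} = 1`
    rw [heatTest_zero_right, caloricSchwartz, mul_zero, SchwartzMap.heatSemigroup_zero,
      one_apply_eq_self, compSchwartz_apply]
  -- `σ > 0`
  set s : ℝ := ν * σ with hsdef
  have hs : 0 < s := mul_pos hν hσ0
  set g : EuclideanSpace ℝ ι → ℂ := fun y => ((φ y l : ℝ) : ℂ) with hg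
  have hg_eq : (compSchwartz hφ l : EuclideanSpace ℝ ι → ℂ) = g := rfl
  set Kc : EuclideanSpace ℝ ι → ℂ := fun y => (heatKernel s y : ℂ) with hKc
  have hKc_int : Integrable Kc := (integrable_heatKernel_holds (E := EuclideanSpace ℝ ι) hs).ofReal
  set ψ : EuclideanSpace ℝ ι → ℂ := Kc ⋆[ContinuousLinearMap.lsmul ℂ ℂ, volume] g with hψ
  -- `ψ` is the complexified component of the caloric extension
  have hψ_eq : ∀ y, ψ y = (((heatExtension φ s y) l : ℝ) : ℂ) := fun y => by
    rw [hψ, convolution_ofReal_heatKernel_eq_heatExtension, coordC_heatExtension hφ hs l y]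
  -- `ψ` is continuous and integrable, with Fourier transform the multiplier of `Φ_l`
  have hψ_cont : Continuous ψ :=
    (hasCompactSupport_coordC_comp hφ l).continuous_convolution_right _ hKc_int.locallyIntegrable
      (contDiff_coordC_comp hφ l).continuous
  have hψ_int : Integrable ψ := hKc_int.integrable_convolution _ (compSchwartz hφ l).integrable
  have hFψ : 𝓕 ψ = (SchwartzMap.smulLeftCLM ℂ (fun ξ : EuclideanSpace ℝ ι => (heatSymbol s ξ : ℂ))
      (𝓕 (compSchwartz hφ l)) : EuclideanSpace ℝ ι → ℂ) := by
    funext ζ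
    have hgi : Integrable g := (compSchwartz hφ l).integrable
    rw [hψ, Real.fourier_smul_convolution_eq hKc_int hgi, hKc,
      fourierIntegral_heatKernel_holds hs, SchwartzMap.smulLeftCLM_heatSymbol_apply hs.le,
      ← hg_eq, ← SchwartzMap.fourier_coe]
  have hFψ_int : Integrable (𝓕 ψ) := by
    rw [hFψ]
    exact SchwartzMap.integrable _
  -- Fourier inversion
  have hinv : 𝓕⁻ (𝓕 ψ) = ψ := hψ_cont.fourierInv_fourier_eq hψ_int hFψ_int
  calc caloricSchwartz hφ ν σ l x = 𝓕⁻ (SchwartzMap.smulLeftCLM ℂ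
        (fun ξ : EuclideanSpace ℝ ι => (heatSymbol s ξ : ℂ)) (𝓕 (compSchwartz hφ l)) :
          EuclideanSpace ℝ ι → ℂ) x := by
        rw [caloricSchwartz, SchwartzMap.heatSemigroup_apply_eq_fourierInv_smulLeftCLM, ← hsdef,
          ← SchwartzMap.fourierInv_coe]
    _ = 𝓕⁻ (𝓕 ψ) x := by rw [hFψ]
    _ = ψ x := by rw [hinv]
    _ = (((heatTest ν φ σ x) l : ℝ) : ℂ) := by rw [hψ_eq, heatTest_of_pos hν hσ0]

/-- The caloric test field is differentiable, for every `ν`, `σ` (from the tree's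
`contDiff_heatFlow`, `MildSolutionProofs.lean`; cf. `contDiff_heatTest`, `LerayHopfMild.lean`). [folklore] -/
theorem differentiable_heatTest (hφ : FunctionSpaces.IsTestFunctionOn (⊤ : Opens (EuclideanSpace ℝ ι)) φ)
    (ν σ : ℝ) : Differentiable ℝ (heatTest ν φ σ) :=
  (contDiff_heatFlow hφ.contDiff hφ.hasCompactSupport (ν * σ)).differentiable (by simp)

/-- **Derivatives of the caloric Schwartz function**: `∂_{e_j}(caloricSchwartz_l)(x)` is the
complexified `l`-component of `D(e^{νσΔ}φ)(x) e_j`. [folklore] -/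
theorem lineDeriv_caloricSchwartz_apply [DecidableEq ι]
    (hφ : FunctionSpaces.IsTestFunctionOn (⊤ : Opens (EuclideanSpace ℝ ι)) φ)
    (hν : 0 < ν) {σ : ℝ} (hσ : 0 ≤ σ) (l j : ι) (x : EuclideanSpace ℝ ι) :
    ∂_{EuclideanSpace.single j (1 : ℝ)} (caloricSchwartz hφ ν σ l) x =
      (((fderiv ℝ (heatTest ν φ σ) x (EuclideanSpace.single j (1 : ℝ))) l : ℝ) : ℂ) := by
  rw [lineDerivOp_apply_eq_fderiv]
  have hfun : (caloricSchwartz hφ ν σ l : EuclideanSpace ℝ ι → ℂ) = coordC l ∘ heatTest ν φ σ := by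
    funext y
    exact caloricSchwartz_apply hφ hν hσ l y
  rw [hfun, fderiv_comp x (coordC l).differentiableAt (differentiable_heatTest hφ ν σ x),
    (coordC l).fderiv, ContinuousLinearMap.comp_apply, coordC_apply]

/-- **Fourier transform of the derivatives of the caloric Schwartz function**:
`𝓕(∂_{e_j} caloricSchwartz_l)(ζ) = 2πi ζ_j e^{-(2π)²νσ‖ζ‖²} Φ_l(ζ)` (the generic
`fourier_lineDerivOp_single_apply` at `Ψ = caloricSchwartz …`). [folklore] -/
theorem fourier_lineDeriv_caloricSchwartz_apply [DecidableEq ι]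
    (hφ : FunctionSpaces.IsTestFunctionOn (⊤ : Opens (EuclideanSpace ℝ ι)) φ)
    {σ : ℝ} (hνσ : 0 ≤ ν * σ) (l j : ι) (ζ : EuclideanSpace ℝ ι) :
    𝓕 ((∂_{EuclideanSpace.single j (1 : ℝ)} (caloricSchwartz hφ ν σ l) :
      𝓢(EuclideanSpace ℝ ι, ℂ)) : EuclideanSpace ℝ ι → ℂ) ζ =
      (2 * π * Complex.I) * ((ζ j : ℝ) : ℂ) *
        ((heatSymbol (ν * σ) ζ : ℂ) * 𝓕 (compSchwartz hφ l : EuclideanSpace ℝ ι → ℂ) ζ) := by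
  rw [← SchwartzMap.fourier_coe, fourier_lineDerivOp_single_apply, SchwartzMap.fourier_coe,
    fourier_caloricSchwartz_apply hφ hνσ l ζ]

/-! ### Incompressibility on the Fourier side -/

/-- The divergence of a test field in coordinates, complexified:
`∑_l ∂_{e_l}(φ_l^ℂ)(x) = (div φ (x) : ℂ)`. [folklore] -/
theorem sum_lineDeriv_compSchwartz_apply [DecidableEq ι]
    (hφ : FunctionSpaces.IsTestFunctionOn (⊤ : Opens (EuclideanSpace ℝ ι)) φ) (x : EuclideanSpace ℝ ι) :
    ∑ l, ∂_{EuclideanSpace.single l (1 : ℝ)} (compSchwartz hφ l) x =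
      ((VectorCalculus.divergence φ x : ℝ) : ℂ) := by
  rw [divergence_eq_sum_inner_fderiv (EuclideanSpace.basisFun ι ℝ) φ x, Complex.ofReal_sum]
  refine Finset.sum_congr rfl fun l _ => ?_
  have hfun : (compSchwartz hφ l : EuclideanSpace ℝ ι → ℂ) = coordC l ∘ φ := rfl
  rw [lineDerivOp_apply_eq_fderiv, hfun,
    fderiv_comp x (coordC l).differentiableAt (hφ.contDiff.differentiable (by simp) x),
    (coordC l).fderiv, ContinuousLinearMap.comp_apply, coordC_apply, EuclideanSpace.basisFun_apply,
    EuclideanSpace.inner_single_left]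
  simp

/-- **Incompressibility on the Fourier side**: for a divergence-free test field,
`∑_l ζ_l Φ_l(ζ) = 0` at EVERY `ζ` (`𝓕(div φ) = 2πi ∑ ζ_l Φ_l`; Lemarié-Rieusset 2023, (8.8): the
Leray symbol acts as the identity on divergence-free data). The a.e./`L²` twin for weakly
divergence-free fields is `IsWeaklyDivFree.sum_coord_mul_fourier_apply_eq_zero`
(`FujitaKatoLocal.lean`). [cite: Lemarierieusset2023, §8.7 (8.8) (PDF p. 198)] -/
theorem sum_coord_mul_fourier_compSchwartz [DecidableEq ι]
    (hφ : FunctionSpaces.IsTestFunctionOn (⊤ : Opens (EuclideanSpace ℝ ι)) φ)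
    (hdiv : VectorCalculus.IsDivFree φ) (ζ : EuclideanSpace ℝ ι) :
    ∑ l, ((ζ l : ℝ) : ℂ) * 𝓕 (compSchwartz hφ l : EuclideanSpace ℝ ι → ℂ) ζ = 0 := by
  set D : 𝓢(EuclideanSpace ℝ ι, ℂ) := ∑ l, ∂_{EuclideanSpace.single l (1 : ℝ)} (compSchwartz hφ l)
    with hD
  have hD0 : D = 0 := by
    ext x
    have hx : D x = ∑ l, ∂_{EuclideanSpace.single l (1 : ℝ)} (compSchwartz hφ l) x := by
      rw [hD]; simp
    rw [hx, sum_lineDeriv_compSchwartz_apply hφ x, hdiv x, Complex.ofReal_zero, zero_apply]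
  have h1 : (𝓕 D) ζ = 0 := by
    rw [hD0]
    simp
  have h2 : (𝓕 D) ζ = ∑ l, (2 * π * Complex.I) * ((ζ l : ℝ) : ℂ) *
      𝓕 (compSchwartz hφ l : EuclideanSpace ℝ ι → ℂ) ζ := by
    set G : ι → 𝓢(EuclideanSpace ℝ ι, ℂ) := fun l =>
      𝓕 (∂_{EuclideanSpace.single l (1 : ℝ)} (compSchwartz hφ l)) with hG
    have hsum : 𝓕 D = ∑ l, G l := by
      rw [hD, ← fourierTransformCLM_apply (𝕜 := ℂ), map_sum]
      rfl
    have hx : (∑ l, G l) ζ = ∑ l, G l ζ := by simp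
    rw [hsum, hx]
    refine Finset.sum_congr rfl fun l _ => ?_
    rw [fourier_lineDerivOp_single_apply _ l ζ, SchwartzMap.fourier_coe]
  rw [h2] at h1
  have hc : (2 * π * Complex.I : ℂ) ≠ 0 := by simp [Real.pi_ne_zero, Complex.I_ne_zero]
  have h3 : (2 * π * Complex.I) * ∑ l, ((ζ l : ℝ) : ℂ) * 𝓕 (compSchwartz hφ l : EuclideanSpace ℝ ι → ℂ) ζ = 0 := by
    rw [Finset.mul_sum]
    simpa only [mul_assoc] using h1
  exact (mul_eq_zero.1 h3).resolve_left hc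

/-! ### The quadratic form of the caloric test field -/

/-- **The quadratic form** `⟪w, D(e^{νσΔ}φ)(x) w⟫ = ∑_{l,j} w_l w_j ∂_{e_j}(caloricSchwartz_l)(x)`
(complexified), the integrand of the nonlinear duality term `∫ ⟪u, (u·∇) e^{νσΔ}φ⟫`
(`(u·∇)ψ = Dψ(u) = ∑_j u_j ∂_jψ`; Lemarié-Rieusset 2023, (8.8), the transformed convective
term). [cite: Lemarierieusset2023, §8.7 (8.8) (PDF p. 198)] -/
theorem inner_fderiv_heatTest_eq_sum [DecidableEq ι]
    (hφ : FunctionSpaces.IsTestFunctionOn (⊤ : Opens (EuclideanSpace ℝ ι)) φ)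
    (hν : 0 < ν) {σ : ℝ} (hσ : 0 ≤ σ) (x w : EuclideanSpace ℝ ι) :
    ((⟪w, fderiv ℝ (heatTest ν φ σ) x w⟫_ℝ : ℝ) : ℂ) =
      ∑ l, ∑ j, ((w l : ℝ) : ℂ) * ((w j : ℝ) : ℂ) *
        ∂_{EuclideanSpace.single j (1 : ℝ)} (caloricSchwartz hφ ν σ l) x := by
  set A := fderiv ℝ (heatTest ν φ σ) x with hA
  -- expand `w` in the standard basis inside `A`
  have hexp : w = ∑ j, (w j) • EuclideanSpace.single j (1 : ℝ) := by
    simpa using ((EuclideanSpace.basisFun ι ℝ).sum_repr w).symm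
  have hAw : ∀ l, (A w) l = ∑ j, w j * (A (EuclideanSpace.single j (1 : ℝ))) l := by
    intro l
    conv_lhs => rw [hexp]
    rw [map_sum]
    simp [Finset.sum_apply, map_smul]
  rw [PiLp.inner_apply, Complex.ofReal_sum]
  refine Finset.sum_congr rfl fun l _ => ?_
  rw [show ⟪w l, (A w) l⟫_ℝ = w l * (A w) l from by simp [mul_comm], hAw l, Finset.mul_sum,
    Complex.ofReal_sum]
  refine Finset.sum_congr rfl fun j _ => ?_
  rw [lineDeriv_caloricSchwartz_apply hφ hν hσ l j x, ← hA]
  push_cast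
  ring

end Caloric

/-! ### Gradients of scalar test functions -/

section Gradient

variable {θ : EuclideanSpace ℝ ι → ℝ}

/-- A real scalar test function, complexified, as a Schwartz function. [folklore] -/
def scalarSchwartz (hθ : FunctionSpaces.IsTestFunctionOn (⊤ : Opens (EuclideanSpace ℝ ι)) θ) :
    𝓢(EuclideanSpace ℝ ι, ℂ) :=
  (hθ.hasCompactSupport.comp_left Complex.ofReal_zero).toSchwartzMap
    (Complex.ofRealCLM.contDiff.comp hθ.contDiff)

/-- Values of `scalarSchwartz`. [folklore] -/
@[simp]
theorem scalarSchwartz_apply (hθ : FunctionSpaces.IsTestFunctionOn (⊤ : Opens (EuclideanSpace ℝ ι)) θ)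
    (x : EuclideanSpace ℝ ι) : scalarSchwartz hθ x = ((θ x : ℝ) : ℂ) := rfl

/-- Coordinate derivatives of `scalarSchwartz` are the complexified partial derivatives. [folklore] -/
theorem lineDeriv_scalarSchwartz_apply [DecidableEq ι]
    (hθ : FunctionSpaces.IsTestFunctionOn (⊤ : Opens (EuclideanSpace ℝ ι)) θ) (l : ι) (x : EuclideanSpace ℝ ι) :
    ∂_{EuclideanSpace.single l (1 : ℝ)} (scalarSchwartz hθ) x =
      ((fderiv ℝ θ x (EuclideanSpace.single l (1 : ℝ)) : ℝ) : ℂ) := by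
  have hfun : (scalarSchwartz hθ : EuclideanSpace ℝ ι → ℂ) = Complex.ofRealCLM ∘ θ := rfl
  rw [lineDerivOp_apply_eq_fderiv, hfun,
    fderiv_comp x Complex.ofRealCLM.differentiableAt (hθ.contDiff.differentiable (by simp) x),
    Complex.ofRealCLM.fderiv, ContinuousLinearMap.comp_apply, Complex.ofRealCLM_apply]

/-- **The gradient pairing in coordinates**: `⟪w, ∇θ(x)⟫ = ∑_l w_l ∂_{e_l}(θ^ℂ)(x)` (complexified;
`⟪w, ∇θ⟫ = Dθ(w)`, tree `inner_gradient_eq_fderiv_apply`). [folklore] -/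
theorem inner_gradient_eq_sum [DecidableEq ι]
    (hθ : FunctionSpaces.IsTestFunctionOn (⊤ : Opens (EuclideanSpace ℝ ι)) θ) (x w : EuclideanSpace ℝ ι) :
    ((⟪w, gradient θ x⟫_ℝ : ℝ) : ℂ) = ∑ l, ((w l : ℝ) : ℂ) * ∂_{EuclideanSpace.single l (1 : ℝ)} (scalarSchwartz hθ) x := by
  haveI : CompleteSpace (EuclideanSpace ℝ ι) := FiniteDimensional.complete ℝ _
  rw [inner_gradient_eq_fderiv_apply]
  have hexp : w = ∑ l, (w l) • EuclideanSpace.single l (1 : ℝ) := by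
    simpa using ((EuclideanSpace.basisFun ι ℝ).sum_repr w).symm
  conv_lhs => rw [hexp]
  rw [map_sum, Complex.ofReal_sum]
  refine Finset.sum_congr rfl fun l _ => ?_
  rw [map_smul, lineDeriv_scalarSchwartz_apply hθ l x, smul_eq_mul, Complex.ofReal_mul]

end Gradient

end Literature.Analysis.FluidPDE.FujitaKato
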